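import Summits.BirchSwinnertonDyer.BirchSwinnertonDyer.Theorems.EisensteinPrimesTwistDeformationCofree
import HarnessLib

/-!
# Route `EisensteinPrimes` (rung K5), crux 2 `GoodLatticeBDPValue`, line `halves` v5, stub
# `stub_noPseudoNull`, road (γ): Greenberg 2010 Lemma 5.2.2 IN FULL for the twist deformation —
# LOC_v⁽¹⁾(`𝐃`) and LOC_v⁽²⁾(`𝐃`) at every place whose decomposition group is non-trivial in
# `Γ = Gal(K̃_∞/K)` (helper for stmt-BirchSwinnertonDyer-19032)

Cell `bsd-eis`, seat `bsd-eis-k5-c2` (gen 8); third kernel file of road (γ) after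
`EisensteinPrimesTwistDeformationMahler` / `…Cofree` (the structure theorem
`nonempty_linearEquiv_of_isDualPairing`: every balanced `C`-dual of `𝐃 = IndModule₂ ℤ_[p] p A` is
`≃ₗ Λ₂`) and `EisensteinPrimesGreenbergFullAtSelmer` (Prop. 4.1.1 (c) applied to `𝓛_η`, leaving
RFX / LEO / LOC⁽²⁾ / CRK / one LOC⁽¹⁾). HERE:

* §1 `groupLike R c = γ^c = ∑ₙ binom(c, n) Tⁿ ∈ R⟦T⟧` and **`translate_eq_groupLike_smul`: the
  translation `τ_c` of the co-induced module IS multiplication by `γ^c`** (Newton's forward-difference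
  formula at a `p`-adic argument, `apply_add_eq_sum`, from the terminating Mahler expansion and local
  constancy in `c`) — the Iwasawa–Serre dictionary `γ ↦ 1 + T` on the module side.
* §2 `localRep_twistDeformation_eq_smul`: an element `σ ∈ Γ_{K_v}` acting on `D = A` by a scalar
  `t` acts on `𝐃` as the element `t · γ₁^{-κ₁(σ)} γ₂^{-κ₂(σ)} ∈ Λ₂`.
* §3 **`twistDeformation_LOC1`** ([Greenberg2010] Lemma 5.2.2: "Suppose that `v ∈ Σ` and that the
  decomposition subgroup of `Γ` for `v` is nontrivial. Then `H⁰(K_v, T*) = 0`."; [Greenberg2016Selmer]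
  §4.3 p. 20: "that hypothesis holds for any prime `η` which does not split completely in `K_∞/K`"):
  for `A` `p`-primary of corank one with respect to `K̄ˣ`-duality (`ℤ_p ≅ Hom(A, K̄ˣ)` through
  `jU : A → K̄ˣ`, on which `σ` acts by a scalar `u` — the cyclotomic character), ANY
  `σ ∈ Γ_{K_v}` with `κ(σ) ≠ 0` acting on `A` by a unit scalar `t` gives LOC_v⁽¹⁾(`𝐃`): an equivariant
  `f = momentPairing jU F` satisfies `F · tγ^{-κ(σ)} = u · F` in the DOMAIN `Λ₂`, and
  `tγ^{-κ(σ)} ≠ u` as soon as `κ(σ) ≠ 0`. This supersedes the axis-restricted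
  `Greenberg2006.twistDeformation_LOC1_of_snd/_of_fst` (which needed `σ ∈ ker θ ∩ ker χ_p`): no
  condition on `θ(σ)` or `χ_p(σ)`, any generator pair `(κ₁, κ₂)`.
* §4 **`twistDeformation_LOC2`**: under the same hypotheses the `Λ₂`-module `T*/(T*)^{G_{K_v}}` is
  reflexive — `(T*)^{G_{K_v}} = 0` (§3) and `T* ≃ₗ Λ₂` (the structure theorem with `C = K̄ˣ`).

Elementary given the structure theorem; theorems and one definition with body (`groupLike`); no
named fact, no `sorry`. HONEST FRAMING: closes nothing by itself (`--supports`); the Galois-side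
supply of such `σ` at each `v ∈ Σ` (every finite prime of `K` is finitely decomposed in
`K_∞^{cyc} ⊆ K̃_∞`; `v ∣ p` ramifies), the archimedean places (trivial decomposition group: LOC⁽²⁾
by `T*/T* = 0`), LEO, CRK and the Shapiro bridge remain. References: [Greenberg2010] R. Greenberg,
*Surjectivity of the global-to-local map defining a Selmer group*, Kyoto J. Math. 50 (2010) §5,
Lemma 5.2.2 (PDF p. 28); [Greenberg2016Selmer] §2.1 p. 6 (LOC⁽¹⁾, LOC⁽²⁾), §4.3 p. 20 L23–30;
[Greenberg2006] p. 342 L1–11.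
-/

set_option autoImplicit false
set_option linter.dupNamespace false

noncomputable section

open scoped Classical
open Finset PowerSeries NumberField IsDedekindDomain Field
open Literature.NumberTheory.EllipticCurves Literature.NumberTheory.GaloisRepresentations
  Literature.NumberTheory.IwasawaTheory.Greenberg2016 Literature.NumberTheory.IwasawaTheory.Greenberg2006

namespace Summit.BirchSwinnertonDyer.BirchSwinnertonDyer.Theorems.TwistDeformationCofree
/-! ## §1 The group-like elements `γ^c = (1 + T)^c = ∑ₙ binom(c, n) Tⁿ ∈ R⟦T⟧` act as the
translations `τ_c` -/

section GroupLike

variable {p : ℕ} [Fact p.Prime] {R : Type*} [CommRing R] [Algebra ℤ_[p] R] {B : Type*}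
  [AddCommGroup B] [Module R B] [Module ℤ_[p] B] [IsScalarTower ℤ_[p] R B]

variable (R) in
/-- **The group-like element `γ^c = (1 + T)^c := ∑ₙ binom(c, n) Tⁿ` of `R⟦T⟧`** for `c ∈ ℤ_p` — the
image of `γ^c ∈ Γ ⊂ ℤ_p[[Γ]]` under the Iwasawa–Serre isomorphism `γ ↦ 1 + T` (for `c ∈ ℕ` it is
literally `(1 + T)^c`). [cite: Greenberg2010, §5 (PDF p. 26 L1–4) (γᵢ ↦ 1 + xᵢ)] -/
def groupLike (c : ℤ_[p]) : PowerSeries R := PowerSeries.mk fun n ↦ algebraMap ℤ_[p] R (Ring.choose c n)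

/-- The coefficients of `γ^c` are the binomials `binom(c, n)`. [folklore] -/
@[simp] theorem coeff_groupLike (c : ℤ_[p]) (n : ℕ) :
    coeff n (groupLike R c) = algebraMap ℤ_[p] R (Ring.choose c n) :=
  coeff_mk _ _

/-- The constant coefficient of `γ^c` is `1`. [folklore] -/
theorem coeff_zero_groupLike (c : ℤ_[p]) : coeff 0 (groupLike R c) = 1 := by
  rw [coeff_groupLike, Ring.choose_zero_right, map_one]

/-- The linear coefficient of `γ^c` is `c`. [folklore] -/
theorem coeff_one_groupLike (c : ℤ_[p]) : coeff 1 (groupLike R c) = algebraMap ℤ_[p] R c := by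
  rw [coeff_groupLike, Ring.choose_one_right]

omit [Algebra ℤ_[p] R] [Module ℤ_[p] B] [IsScalarTower ℤ_[p] R B] in
/-- Moments beyond a nilpotency exponent vanish pointwise. [folklore] -/
theorem shiftSubOne_pow_apply_eq_zero_of_le {N i : ℕ} {Φ : BigRepModule R p B}
    (hN : ((BigRepModule.shiftSubOne ^ N : BigRepModule R p B →ₗ[R] BigRepModule R p B) Φ) = 0)
    (hi : N ≤ i) (x : ℤ_[p]) :
    ((BigRepModule.shiftSubOne ^ i : BigRepModule R p B →ₗ[R] BigRepModule R p B) Φ) x = 0 := by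
  rw [← Nat.sub_add_cancel hi, pow_add, Module.End.mul_apply, hN, LinearMap.map_zero,
    BigRepModule.zero_apply]

omit [Algebra ℤ_[p] R] [IsScalarTower ℤ_[p] R B] in
/-- **Newton's forward-difference formula at a NATURAL argument**, truncated at a nilpotency
exponent: `Φ(x + n) = ∑_{i<N} binom(n, i) • ((τ₁ - 1)^i Φ)(x)` when `(τ₁ - 1)^N Φ = 0`.
(Mathlib `shift_eq_sum_fwdDiff_iter`.) [folklore] -/
theorem apply_add_natCast_eq_sum {N : ℕ} {Φ : BigRepModule R p B}
    (hN : ((BigRepModule.shiftSubOne ^ N : BigRepModule R p B →ₗ[R] BigRepModule R p B) Φ) = 0)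
    (x : ℤ_[p]) (n : ℕ) :
    Φ (x + n) = ∑ i ∈ range N, Ring.choose (n : ℤ_[p]) i •
      ((BigRepModule.shiftSubOne ^ i : BigRepModule R p B →ₗ[R] BigRepModule R p B) Φ) x := by
  have h := shift_eq_sum_fwdDiff_iter (1 : ℤ_[p]) (⇑Φ) n x
  rw [nsmul_eq_mul, mul_one] at h
  rw [h]
  -- both sides are the sum over `range (N + (n + 1))` of `n.choose i • Δ^[i] Φ x`
  have e₁ : ∑ k ∈ range (n + 1), n.choose k • (fwdDiff (1 : ℤ_[p]))^[k] (⇑Φ) x =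
      ∑ k ∈ range (N + (n + 1)), n.choose k • (fwdDiff (1 : ℤ_[p]))^[k] (⇑Φ) x :=
    sum_subset (range_subset_range.mpr (by omega)) fun k _ hk ↦ by
      rw [mem_range, not_lt] at hk
      rw [Nat.choose_eq_zero_of_lt (by omega), zero_smul]
  have e₂ : ∑ i ∈ range N, Ring.choose (n : ℤ_[p]) i •
        ((BigRepModule.shiftSubOne ^ i : BigRepModule R p B →ₗ[R] BigRepModule R p B) Φ) x =
      ∑ k ∈ range (N + (n + 1)), n.choose k • (fwdDiff (1 : ℤ_[p]))^[k] (⇑Φ) x := by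
    have e₃ : ∀ i, Ring.choose (n : ℤ_[p]) i •
        ((BigRepModule.shiftSubOne ^ i : BigRepModule R p B →ₗ[R] BigRepModule R p B) Φ) x =
        n.choose i • (fwdDiff (1 : ℤ_[p]))^[i] (⇑Φ) x := fun i ↦ by
      rw [Ring.choose_natCast, Nat.cast_smul_eq_nsmul, shiftSubOne_pow_apply]
    simp_rw [e₃]
    refine sum_subset (range_subset_range.mpr (by omega)) fun k _ hk ↦ ?_
    rw [mem_range, not_lt] at hk
    rw [← shiftSubOne_pow_apply, shiftSubOne_pow_apply_eq_zero_of_le hN hk, smul_zero]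
  rw [e₁, e₂]

omit [Algebra ℤ_[p] R] [IsScalarTower ℤ_[p] R B] in
/-- **Newton's forward-difference formula at a `p`-ADIC argument**: `Φ(x + c) = ∑_{i<N} binom(c, i) •
((τ₁ - 1)^i Φ)(x)` for every `c ∈ ℤ_p` when `(τ₁ - 1)^N Φ = 0` — both sides are locally constant in
`c` (the moments are `p`-power torsion, `binom(·, i)` is continuous) and agree on the dense `ℕ ⊂ ℤ_p`.
[folklore] -/
theorem apply_add_eq_sum {N : ℕ} {Φ : BigRepModule R p B}
    (hN : ((BigRepModule.shiftSubOne ^ N : BigRepModule R p B →ₗ[R] BigRepModule R p B) Φ) = 0)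
    (x c : ℤ_[p]) :
    Φ (x + c) = ∑ i ∈ range N, Ring.choose c i •
      ((BigRepModule.shiftSubOne ^ i : BigRepModule R p B →ₗ[R] BigRepModule R p B) Φ) x := by
  -- the moments are `p^k`-torsion
  obtain ⟨k, hk⟩ := exists_pow_smul_eq_zero Φ
  have htor : ∀ i : ℕ, p ^ k •
      ((BigRepModule.shiftSubOne ^ i : BigRepModule R p B →ₗ[R] BigRepModule R p B) Φ) x = 0 :=
    fun i ↦ by rw [← BigRepModule.nsmul_apply, ← map_nsmul, hk, LinearMap.map_zero,
      BigRepModule.zero_apply]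
  -- a common level for `c ↦ Φ (x + c)` and the finitely many `c ↦ binom(c, i) • moment_i`
  obtain ⟨n₀, hn₀⟩ := Φ.exists_level
  choose lev hlev using fun i : ℕ ↦ exists_isSmoothOfLevel_choose_smul (htor i) i
  set m : ℕ := n₀ + (range N).sup lev with hm
  -- replace `c` by the natural number `c mod p^m`
  have hcc : c - ((c.appr m : ℕ) : ℤ_[p]) ∈ Ideal.span {(p : ℤ_[p]) ^ m} := PadicInt.appr_spec m c
  have hL : Φ (x + c) = Φ (x + ((c.appr m : ℕ) : ℤ_[p])) :=
    hn₀ _ _ (Ideal.span_singleton_le_span_singleton.mpr (pow_dvd_pow _ (Nat.le_add_right _ _))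
      (by rwa [add_sub_add_left_eq_sub]))
  have hR : ∀ i ∈ range N, Ring.choose c i •
      ((BigRepModule.shiftSubOne ^ i : BigRepModule R p B →ₗ[R] BigRepModule R p B) Φ) x =
      Ring.choose ((c.appr m : ℕ) : ℤ_[p]) i •
      ((BigRepModule.shiftSubOne ^ i : BigRepModule R p B →ₗ[R] BigRepModule R p B) Φ) x :=
    fun i hi ↦ hlev i _ _ (Ideal.span_singleton_le_span_singleton.mpr
      (pow_dvd_pow _ ((le_sup (f := lev) hi).trans (Nat.le_add_left _ _))) hcc)
  rw [hL, apply_add_natCast_eq_sum hN, sum_congr rfl hR]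

/-- **`τ_c = γ^c`: translation by `c ∈ ℤ_p` is multiplication by the group-like element
`(1 + T)^c ∈ R⟦T⟧`** on the co-induced module (`R` a `ℤ_p`-algebra acting compatibly on the values).
[cite: Greenberg2010, §5 (PDF p. 26 L1–4)] [cite: Castella2018, §2.2 (ℤ_p[[T]] = Λ via 1 + T ↦ γ)] -/
theorem translate_eq_groupLike_smul (c : ℤ_[p]) (Φ : BigRepModule R p B) :
    BigRepModule.translate c Φ = groupLike R c • Φ := by
  obtain ⟨N, hN⟩ := BigRepModule.shiftSubOne_locNil Φ
  ext x
  rw [BigRepModule.translate_apply, powerSeries_smul_apply_eq_sum hN, apply_add_eq_sum hN]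
  refine sum_congr rfl fun i _ ↦ ?_
  rw [coeff_groupLike, algebraMap_smul]

end GroupLike

/-! ## §2 An element of `Γ_{K_v}` with scalar action on `A` acts on `𝐃` through `Λ₂` -/

section Local

variable {K : Type} [Field K] [NumberField K] (S : Set (HeightOneSpectrum (𝓞 K))) {p : ℕ} [Fact p.Prime]
  {A : Type} [AddCommGroup A] [Module ℤ_[p] A] [TopologicalSpace A] [DiscreteTopology A]
  [TopologicalSpace (PowerSeries ℤ_[p])] [TopologicalSpace (PowerSeries (PowerSeries ℤ_[p]))]
  (hS : ∀ v : HeightOneSpectrum (𝓞 K), ((p : ℕ) : 𝓞 K) ∈ v.asIdeal → v ∈ S)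
  (κ₁ κ₂ : ZpExtension K p) (ρ₀ : ContinuousRep (GaloisGroupUnramifiedOutside K S) ℤ_[p] A)

/-- **`σ` acts on `𝐃 = Ind(A)` as the element `t · γ₁^{-κ₁(σ)} · γ₂^{-κ₂(σ)}` of `Λ₂`** when it acts
on `A` by the scalar `t`: `(σ · Φ)(x)(y) = t • Φ(x - κ₁σ)(y - κ₂σ)` and translations are the
group-like elements (`translate_eq_groupLike_smul`, in each variable).
[cite: Greenberg2006, p. 342 L1–11 (ρ = ρ₀ ⊗ κ^{-1})] [cite: Greenberg2010, §5 (PDF p. 26 L1–17)] -/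
theorem localRep_twistDeformation_eq_smul (v : Place K) (σ : absoluteGaloisGroup v.Completion)
    {t : ℤ_[p]} (ht : ∀ a : A, ρ₀ (localToUnramified S v σ) a = t • a) (Φ : IndModule₂ ℤ_[p] p A) :
    localRep S (twistDeformation S hS κ₁ κ₂ ρ₀) v σ Φ =
      (PowerSeries.C (PowerSeries.C t) *
        (groupLike (PowerSeries ℤ_[p]) (-(κ₁ (absGaloisRestrict K v.Completion σ)).toAdd) *
          PowerSeries.C (groupLike ℤ_[p] (-(κ₂ (absGaloisRestrict K v.Completion σ)).toAdd)))) • Φ := by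
  ext x y
  show ρ₀ (localToUnramified S v σ) (Φ (x - (κ₁ (absGaloisRestrict K v.Completion σ)).toAdd)
    (y - (κ₂ (absGaloisRestrict K v.Completion σ)).toAdd)) = _
  rw [ht, mul_smul, IndModule₂.C_C_smul_apply, mul_smul, ← translate_eq_groupLike_smul,
    BigRepModule.translate_apply, BigRepModule.C_smul, BigRepModule.smul_apply,
    ← translate_eq_groupLike_smul, BigRepModule.translate_apply, ← sub_eq_add_neg, ← sub_eq_add_neg]

omit [TopologicalSpace (PowerSeries ℤ_[p])] [TopologicalSpace (PowerSeries (PowerSeries ℤ_[p]))] in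
/-- The element `t · γ₁^{-c₁} γ₂^{-c₂} ∈ Λ₂` is NOT the constant `u` when `(c₁, c₂) ≠ (0, 0)` and `t` is a
unit (read off the coefficient of `T₁`, resp. of `T₂` in the constant-in-`T₁` term; `ℤ_p` a domain).
[cite: Greenberg2010, Lemma 5.2.2 (PDF p. 28 L20–21)] -/
theorem C_mul_groupLike_mul_ne_C (t : ℤ_[p]ˣ) (u : ℤ_[p]) {c₁ c₂ : ℤ_[p]} (hc : c₁ ≠ 0 ∨ c₂ ≠ 0) :
    (PowerSeries.C (PowerSeries.C (t : ℤ_[p])) *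
        (groupLike (PowerSeries ℤ_[p]) c₁ * PowerSeries.C (groupLike ℤ_[p] c₂)) :
      IwasawaAlgebra₂ p) ≠ PowerSeries.C (PowerSeries.C u) := by
  have ht0 : (t : ℤ_[p]) ≠ 0 := t.ne_zero
  have hg₂ : groupLike ℤ_[p] c₂ ≠ 0 := fun h ↦ by
    have := congr_arg (coeff 0) h
    rw [coeff_zero_groupLike, map_zero] at this
    exact one_ne_zero this
  intro h
  rcases hc with h₁ | h₂
  · have e := congr_arg (coeff 1) h
    rw [coeff_C_mul, coeff_mul_C, coeff_one_groupLike, coeff_C, if_neg one_ne_zero,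
      ← C_eq_algebraMap] at e
    exact mul_ne_zero ((map_ne_zero_iff _ (C_injective (R := ℤ_[p]))).mpr ht0)
      (mul_ne_zero ((map_ne_zero_iff _ (C_injective (R := ℤ_[p]))).mpr h₁) hg₂) e
  · have e := congr_arg (coeff 0) h
    rw [coeff_C_mul, coeff_mul_C, coeff_zero_groupLike, one_mul, coeff_C, if_pos rfl] at e
    have e' := congr_arg (coeff 1) e
    rw [coeff_C_mul, coeff_one_groupLike, Algebra.algebraMap_self, RingHom.id_apply, coeff_C,
      if_neg one_ne_zero] at e'
    exact mul_ne_zero ht0 h₂ e'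

/-! ## §3 Lemma 5.2.2: LOC_v⁽¹⁾(`𝐃`) from ANY `σ ∈ Γ_{K_v}` with `κ(σ) ≠ 0` -/

/-- **Greenberg 2010 Lemma 5.2.2 for the twist deformation — LOC_v⁽¹⁾(`𝐃`): `(T*)^{G_{K_v}} = 0`
whenever the decomposition group at `v` has non-trivial image in `Γ`.** Hypotheses: `A` is
`p`-primary and of corank one for `K̄ˣ`-duality through `jU : A → K̄ˣ` (`hinj`, `hsurj`: `ℤ_p ≅
Hom(A, K̄ˣ)`, `c ↦ jU ∘ (c • ·)` — e.g. `A ≅ ℚ_p/ℤ_p ≅ μ_{p^∞}`); `σ ∈ Γ_{K_v}` acts on `A` by a unit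
scalar `t` (= `θ(σ)` for `A = A_θ`), on `jU(A) ⊆ μ_{p^∞}` by a scalar `u` (= `χ_p(σ)`), and
`κ(σ) = (κ₁σ, κ₂σ) ≠ 0`. Then every `Γ_{K_v}`-equivariant additive `f : 𝐃 → K̄ˣ` vanishes: `f` is a
moment functional `momentPairing jU F` (surjectivity), equivariance at `σ` reads
`F · tγ₁^{-κ₁σ}γ₂^{-κ₂σ} = u · F` in `Λ₂` (injectivity), `Λ₂` is a domain and
`tγ^{-κ(σ)} ≠ u`. No condition on `θ(σ)`, `χ_p(σ)` or the generator pair.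
[cite: Greenberg2010, Lemma 5.2.2 (PDF p. 28 L20–21)] [cite: Greenberg2016Selmer, §4.3 p. 20 L26–30] -/
theorem twistDeformation_LOC1 (hA : ∀ a : A, ∃ k : ℕ, p ^ k • a = 0)
    (jU : A →+ DiscreteGaloisModule.UnitsCarrier K)
    (hinj : ∀ c : ℤ_[p], (∀ a : A, jU (c • a) = 0) → c = 0)
    (hsurj : ∀ φ : A →+ DiscreteGaloisModule.UnitsCarrier K, ∃ c : ℤ_[p], ∀ a : A, φ a = jU (c • a))
    (v : Place K) (σ : absoluteGaloisGroup v.Completion) (t : ℤ_[p]ˣ) {u : ℤ_[p]}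
    (ht : ∀ a : A, ρ₀ (localToUnramified S v σ) a = (t : ℤ_[p]) • a)
    (hu : ∀ a : A, DiscreteGaloisModule.units K (absGaloisRestrict K v.Completion σ) (jU a) = jU (u • a))
    (hσ : κ₁ (absGaloisRestrict K v.Completion σ) ≠ 1 ∨ κ₂ (absGaloisRestrict K v.Completion σ) ≠ 1) :
    LOC1 S (twistDeformation S hS κ₁ κ₂ ρ₀) v := by
  intro f hf
  obtain ⟨F, rfl⟩ := momentPairing_surjective jU hA hsurj f
  set g : IwasawaAlgebra₂ p := PowerSeries.C (PowerSeries.C (t : ℤ_[p])) *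
    (groupLike (PowerSeries ℤ_[p]) (-(κ₁ (absGaloisRestrict K v.Completion σ)).toAdd) *
      PowerSeries.C (groupLike ℤ_[p] (-(κ₂ (absGaloisRestrict K v.Completion σ)).toAdd))) with hg
  -- equivariance at `σ`, read through the (injective) moment pairing
  have key : F * g = PowerSeries.C (PowerSeries.C u) * F := by
    apply momentPairing_injective jU hA hinj
    ext Φ
    have e := hf σ Φ
    rw [momentPairing_apply, momentPairing_apply, localRep_twistDeformation_eq_smul S hS κ₁ κ₂ ρ₀ v σ ht,
      ← hg, ← mul_smul, hu, ← IndModule₂.C_C_smul_apply, ← mul_smul] at e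
    rw [momentPairing_apply, momentPairing_apply]
    exact e
  have hc : -(κ₁ (absGaloisRestrict K v.Completion σ)).toAdd ≠ 0 ∨
      -(κ₂ (absGaloisRestrict K v.Completion σ)).toAdd ≠ 0 := by
    rcases hσ with h | h
    · exact Or.inl (neg_ne_zero.mpr fun h0 ↦ h (toAdd_eq_zero.mp h0))
    · exact Or.inr (neg_ne_zero.mpr fun h0 ↦ h (toAdd_eq_zero.mp h0))
  have hgu : g ≠ PowerSeries.C (PowerSeries.C u) := C_mul_groupLike_mul_ne_C t u hc
  have hF : F = 0 := by
    have h0 : F * (g - PowerSeries.C (PowerSeries.C u)) = 0 := by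
      rw [mul_sub, key]; ring
    rcases mul_eq_zero.mp h0 with h | h
    · exact h
    · exact absurd (sub_eq_zero.mp h) hgu
  rw [hF, map_zero]

/-! ## §4 LOC_v⁽²⁾(`𝐃`): `T*/(T*)^{G_{K_v}} = T* ≃ Λ₂` is reflexive -/

/-- Under the hypotheses of `twistDeformation_LOC1`, the invariants `(T*)^{G_{K_v}}` of every Tate dual
`T* ≅ Hom(𝐃, K̄ˣ)` vanish. [cite: Greenberg2010, Lemma 5.2.2 (PDF p. 28 L20–21)] -/
theorem tateDualInvariants_twistDeformation_eq_bot (hA : ∀ a : A, ∃ k : ℕ, p ^ k • a = 0)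
    (jU : A →+ DiscreteGaloisModule.UnitsCarrier K)
    (hinj : ∀ c : ℤ_[p], (∀ a : A, jU (c • a) = 0) → c = 0)
    (hsurj : ∀ φ : A →+ DiscreteGaloisModule.UnitsCarrier K, ∃ c : ℤ_[p], ∀ a : A, φ a = jU (c • a))
    (v : Place K) (σ : absoluteGaloisGroup v.Completion) (t : ℤ_[p]ˣ) {u : ℤ_[p]}
    (ht : ∀ a : A, ρ₀ (localToUnramified S v σ) a = (t : ℤ_[p]) • a)
    (hu : ∀ a : A, DiscreteGaloisModule.units K (absGaloisRestrict K v.Completion σ) (jU a) = jU (u • a))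
    (hσ : κ₁ (absGaloisRestrict K v.Completion σ) ≠ 1 ∨ κ₂ (absGaloisRestrict K v.Completion σ) ≠ 1)
    {Y : Type} [AddCommGroup Y] [Module (IwasawaAlgebra₂ p) Y]
    (toDual : Y →+ (IndModule₂ ℤ_[p] p A →+ DiscreteGaloisModule.UnitsCarrier K))
    (hY : IsDualPairing (IwasawaAlgebra₂ p) (IndModule₂ ℤ_[p] p A) toDual) :
    tateDualInvariants S (twistDeformation S hS κ₁ κ₂ ρ₀) v toDual hY = ⊥ := by
  rw [Submodule.eq_bot_iff]
  intro y hy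
  have h0 : toDual y = 0 :=
    twistDeformation_LOC1 S hS κ₁ κ₂ ρ₀ hA jU hinj hsurj v σ t ht hu hσ (toDual y)
      ((mem_tateDualInvariants_iff S _ v toDual hY y).mp hy)
  exact hY.injective (by rw [h0, map_zero])

/-- **LOC_v⁽²⁾(`𝐃`) for the twist deformation at a place with non-trivial decomposition group in
`Γ`**: "The `Λ`-module `T*/(T*)^{G_{K_v}}` is reflexive" — here `(T*)^{G_{K_v}} = 0`
(`tateDualInvariants_twistDeformation_eq_bot`) and `T* ≃ₗ Λ₂` (`nonempty_linearEquiv_of_isDualPairing`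
with `C = K̄ˣ`), a finite free, hence reflexive, `Λ₂`-module ([Greenberg2016Selmer] p. 20: "it is
shown in part F of section 5 in [Gr4] that LOC_v⁽²⁾(`𝒟`) is satisfied for all `v` in `Σ`").
[cite: Greenberg2016Selmer, §2.1 p. 6 L1–10, §4.3 p. 20 L23–26] [cite: Greenberg2010, Lemma 5.2.2 (PDF p. 28)] -/
theorem twistDeformation_LOC2 (hA : ∀ a : A, ∃ k : ℕ, p ^ k • a = 0)
    (jU : A →+ DiscreteGaloisModule.UnitsCarrier K)
    (hinj : ∀ c : ℤ_[p], (∀ a : A, jU (c • a) = 0) → c = 0)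
    (hsurj : ∀ φ : A →+ DiscreteGaloisModule.UnitsCarrier K, ∃ c : ℤ_[p], ∀ a : A, φ a = jU (c • a))
    (v : Place K) (σ : absoluteGaloisGroup v.Completion) (t : ℤ_[p]ˣ) {u : ℤ_[p]}
    (ht : ∀ a : A, ρ₀ (localToUnramified S v σ) a = (t : ℤ_[p]) • a)
    (hu : ∀ a : A, DiscreteGaloisModule.units K (absGaloisRestrict K v.Completion σ) (jU a) = jU (u • a))
    (hσ : κ₁ (absGaloisRestrict K v.Completion σ) ≠ 1 ∨ κ₂ (absGaloisRestrict K v.Completion σ) ≠ 1) :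
    LOC2 S (twistDeformation S hS κ₁ κ₂ ρ₀) v := by
  intro Y _ _ toDual hY
  obtain ⟨e⟩ := nonempty_linearEquiv_of_isDualPairing jU hA hinj hsurj hY
  let e' := ((tateDualInvariants S _ v toDual hY).quotEquivOfEqBot
    (tateDualInvariants_twistDeformation_eq_bot S hS κ₁ κ₂ ρ₀ hA jU hinj hsurj v σ t ht hu hσ
      toDual hY)).trans e
  haveI := Module.Free.of_equiv e'.symm
  haveI := Module.Finite.equiv e'.symm
  exact Module.IsReflexive.of_finite_of_free _ _

end Local

end Summit.BirchSwinnertonDyer.BirchSwinnertonDyer.Theorems.TwistDeformationCofree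

end
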